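import Literature.MathematicalPhysics.QuantumFieldTheory.Balaban1983to89.B8Ineq159CurvedCubeMemberEtaScaling
import Literature.MathematicalPhysics.QuantumFieldTheory.Balaban1983to89.B8Ineq159CurvedCubeMemberShift

/-!
# `Balaban1983to89.B8Ineq159CurvedCubeMemberUniform` — [Balaban1985RegularSpaces] (1.59) p. 86 «for `U₀ ∈ 𝔄_k({□_j}, α₀)`» on the cube member: the
# constants depend ONLY ON THE SHAPE `(L, M, ρ, k)` (and the truncation, `d`, `𝔸`) — NOT on the position `a ∈ ℤᵈ` of the cube and NOT on the lattice
# spacing `η` (translation covariance, file (T); scale covariance, file (S))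

statement-level skeleton of published theorems with citation tags; proofs where landed; nothing here is a claim about the
Yang–Mills mass gap

`[Balaban1985RegularSpaces]` ("B8", CMP **99** (1985) 75–102) p. 77 (`𝔄_k({Ω_j}, α₀)`, (1.7)–(1.8)), (1.38) p. 82, (1.55) p. 86, (1.59) p. 86, (1.62) p. 87, p. 83,
(1.131) p. 99; [4] = `[Balaban1985BackgroundPropagators]` Thm 3.3 p. 399; [B7] = `[Balaban1985Averaging]` Prop. 2 (52)–(54) p. 26, (42)–(43) pp. 23–24;
`[Balaban1987RG1]` (4.16) p. 285.

CITATION HEADER (lean-in-tree rule).  Cell `pub-ymgap` (YM Track A, HUMAN RULING D-0062 ∕ D-0149), DAG node N05 = [B8], width seat `pub-ymgap-dag-n05-w3`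
(g3), CLAIM-1 file (U).  WHY.  Files (V) (the verbatim-`𝔄_k({□_j})` per-member curved (1.59)), (S) (`η`-uniformity) and (T) (translation transport) of this
seat combine to the sharpest per-member statement the kinematics give for free: ONE pair of constants for ALL positions `a` and ALL spacings `η > 0`.  What
remains member-dependent is the SHAPE `(L, M, ρ, k)` (and `m`, `d`, `𝔸`) — uniformity there is [4] Thm 3.3, the N06 object layer.

THE MATHEMATICS (kernel-checked).  ★★★ `exists_curved159_perCube_touching_uniform` (m = 1, `U1`): `∃ α₀ B″, ∀ a, ∀ η > 0, ∀ U₀ …` — file (S)'s `η`-uniform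
theorem at the origin `a = 0`, transported to `a = 0 + a` by `B8Ineq159CurvedCubeMemberShift.curved159_perCube_shift`; ★★★ `exists_curved159_perCube_inAk_verbatim_uniform`
(its `InAk L k′ η α₀ (cubeFam false L a M ρ k) U₀` form); the all-truncations twins `…_tower_uniform`, `…_inAk_verbatim_tower_uniform` (averaging-closed `G`,
`2 ≤ L`), `…_unitary_uniform` (unitary C⋆ backgrounds — the sockets' currency) and ★ `…_inAk_sup_unitary_uniform` (ANY domain sequence with `□₀ ⊆ Ω₀`,
p. 99's «□_j ⊂ Ω_j», via `B8Ineq132.condAt_anti`).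

HONEST SCOPE ∕ A6.  Constants still depend on the member's SHAPE `(L, M, ρ, k)`, the truncation `m`, `d` and `𝔸` (finite-dimensional factorisation upstream;
NOT explicit; NOT print's uniform `α₀`, `B₀(d, L)`); member-dependent powers of `L` in the derivative targets (file (R) §5); only the level-`0` plaquette
clause of (1.7) is used.  NOT an inhabitant of `SockB9P3` ∕ `SockH59` ∕ `CurvAtInAk` as typed (uniformity in `k` = [4] Thm 3.3 = N06).  Non-vacuity: `U₀ = 1`,
`φ = 0`.  Count-neutral; N05 NOT discharged; no count claim; one finite `𝕋⁴` programme at fixed `ε`, Bałaban as printed; the YM mass gap (Clay) is NOT proved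
by any of this — R4 closes the conditional finite-`𝕋⁴` rung `BalabanLadder.UV` only; nothing continuum ∕ ℝ⁴ ∕ OS.  No `sorry`, no `def`, no `instance`, no
`notation`.  Unit `pub-ymgap-dag-n05-w3` (g3), 2026-08-28.
-/

noncomputable section

namespace Literature.MathematicalPhysics.QuantumFieldTheory.Balaban1983to89.B8Ineq159CurvedCubeMemberUniform

open B7Prop1Explicit B7Prop2Explicit B7Prop1Local
open B7Prop4GeneralLevels (linCovIter)
open B8Ineq132 (covDerivFwd BondTouches PlaqTouches plaqF InAk)
open B8Eq140Level (SideTouches)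
open B8Eq146AExpansion (iEta)
open B8Eq155JBound (Jcur)
open B8Eq138LandauZd (IsLandau138 covLap)
open B8Eq131CubesAdmissible (cubeFam)
open B8CubeMemberZd (cubeLamS)
open B8Ineq159FlatCubeMemberPrinted (cubeLamBP)
open B8Ineq159CurvedCubeMemberEtaScaling (exists_curved159_perCube_touching_uniformEta exists_curved159_perCube_touching_tower_uniformEta)
open B8Ineq159CurvedCubeMemberShift (curved159_perCube_shift)

-- `Site` alone would resolve to the torus sites of `Setup.lean`; re-export the `ℤ^d` sites of `B7Prop1Explicit`.
export B7Prop1Explicit (Site)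

variable {d : ℕ}

/-! ## §1 Truncation `1`, `U1`-valued backgrounds -/

section TruncOne

variable {𝔸 : Type*} [NormedRing 𝔸] [NormOneClass 𝔸] [NormedAlgebra ℂ 𝔸] [CompleteSpace 𝔸]

/-- ★★★ **(1.59) ON THE CUBE MEMBER FOR BACKGROUNDS WITH SMALL TOUCHING PLAQUETTES — CONSTANTS UNIFORM IN THE POSITION `a` AND THE SPACING `η`,
TRUNCATION `1`.**  For `d ≥ 2`, `1 ≤ L ≤ ρ`, `k ≥ 1`, a size `M` and `𝔸` finite-dimensional there are `α₀, B″ > 0` (depending on `(L, M, ρ, k)`, `d`, `𝔸` only)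
such that for EVERY position `a ∈ ℤᵈ` and EVERY `η > 0` the statement of `B8Ineq159CurvedCubeMemberInAkVerbatim.exists_curved159_perCube_touching` holds at the
member `(L, a, M, ρ, k)` with these constants.  PROOF: file (S) at `a = 0`, transported by `curved159_perCube_shift` (`0 + a = a`).
[cite: Balaban1985RegularSpaces, (1.59) p.86, (1.62) p.87, p.77, (1.8) p.77, p.83, (1.38) p.82, (1.131) p.99; Balaban1987RG1, (4.16) p.285; Balaban1985BackgroundPropagators, Thm 3.3 p.399] -/
theorem exists_curved159_perCube_touching_uniform [FiniteDimensional ℂ 𝔸] (hd2 : 2 ≤ d) {L : ℕ} (hL : 1 ≤ L)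
    (M : ℕ) {ρ : ℕ} (hρ : L ≤ ρ) {k : ℕ} (hk : 1 ≤ k) :
    ∃ α₀ B'' : ℝ, 0 < α₀ ∧ 0 < B'' ∧ ∀ (a : Site d) (η : ℝ), 0 < η → ∀ (U₀ : Site d → Fin d → 𝔸ˣ), (∀ x κ, U₀ x κ ∈ U1 𝔸) →
      (∀ (z : Site d) (κ μ : Fin d), κ ≠ μ → PlaqTouches (cubeFam false L a M ρ k 0) z κ μ → ‖plaqF U₀ κ μ z - 1‖ ≤ α₀) →
      ∀ φ : Site d → Fin d → 𝔸,
        IsLandau138 L 1 η (cubeFam false L a M ρ k 0) (cubeLamS L a M ρ k 1) U₀ φ →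
        (∀ (y : Site d) (τ : Fin d), (∀ j, j ≤ 1 → ¬ SideTouches (cubeFam false L a M ρ k j) y τ) → φ y τ = 0) →
        ∀ N : ℝ, 0 ≤ N →
          (∀ j, j ≤ 1 → ∀ (y : Site d) (τ : Fin d), BondTouches (cubeFam false L a M ρ k j) y τ →
              ((L : ℝ) ^ j * η) ^ 3 * ‖Jcur η U₀ φ τ y‖ ≤ N) →
          (∀ j, j ≤ 1 → ∀ c ∈ cubeLamBP L a M ρ k 1 j, ‖linCovIter L U₀ (iEta η φ) j c.1 c.2‖ ≤ N) →
          (∀ (y : Site d) (τ : Fin d), ¬ BondTouches (cubeFam false L a M ρ k 0) y τ → η * ‖φ y τ‖ ≤ N) →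
          ∀ j, j ≤ 1 → ∀ (y : Site d) (τ : Fin d), SideTouches (cubeFam false L a M ρ k j) y τ →
            ((L : ℝ) ^ j * η) * ‖φ y τ‖ ≤ B'' * N ∧
            (∀ ν : Fin d, ((L : ℝ) ^ j * η) ^ 2 * ‖covDerivFwd η U₀ ν (fun z => φ z τ) y‖ ≤ B'' * N) ∧
            ((L : ℝ) ^ j * η) ^ 3 * ‖covLap η U₀ (fun z => φ z τ) y‖ ≤ B'' * N := by
  obtain ⟨α₀, B'', hα₀, hB'', H⟩ := exists_curved159_perCube_touching_uniformEta (𝔸 := 𝔸) hd2 hL 0 M hρ hk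
  refine ⟨α₀, B'', hα₀, hB'', fun a η hη => ?_⟩
  have h := curved159_perCube_shift (H := U1 𝔸) hL 0 a M ρ hk (H η hη)
  rw [zero_add] at h
  exact h

/-- ★★★ **(1.59) «FOR `U₀ ∈ 𝔄_k({□_j}, α₀)`» AT THE MEMBER'S OWN DOMAIN SEQUENCE — CONSTANTS UNIFORM IN `a` AND `η`, TRUNCATION `1`**: `∃ α₀ B″` BEFORE
`∀ a, ∀ η > 0` in `B8Ineq159CurvedCubeMemberInAkVerbatim.exists_curved159_perCube_inAk_verbatim`.
[cite: Balaban1985RegularSpaces, (1.59) p.86, (1.7)–(1.8) p.77, p.83; Balaban1987RG1, (4.16) p.285; Balaban1985BackgroundPropagators, Thm 3.3 p.399] -/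
theorem exists_curved159_perCube_inAk_verbatim_uniform [FiniteDimensional ℂ 𝔸] (hd2 : 2 ≤ d) {L : ℕ} (hL : 1 ≤ L)
    (M : ℕ) {ρ : ℕ} (hρ : L ≤ ρ) {k : ℕ} (hk : 1 ≤ k) :
    ∃ α₀ B'' : ℝ, 0 < α₀ ∧ 0 < B'' ∧ ∀ (a : Site d) (η : ℝ), 0 < η → ∀ (U₀ : Site d → Fin d → 𝔸ˣ), (∀ x κ, U₀ x κ ∈ U1 𝔸) →
      ∀ k' : ℕ, InAk L k' η α₀ (cubeFam false L a M ρ k) U₀ →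
      ∀ φ : Site d → Fin d → 𝔸,
        IsLandau138 L 1 η (cubeFam false L a M ρ k 0) (cubeLamS L a M ρ k 1) U₀ φ →
        (∀ (y : Site d) (τ : Fin d), (∀ j, j ≤ 1 → ¬ SideTouches (cubeFam false L a M ρ k j) y τ) → φ y τ = 0) →
        ∀ N : ℝ, 0 ≤ N →
          (∀ j, j ≤ 1 → ∀ (y : Site d) (τ : Fin d), BondTouches (cubeFam false L a M ρ k j) y τ →
              ((L : ℝ) ^ j * η) ^ 3 * ‖Jcur η U₀ φ τ y‖ ≤ N) →
          (∀ j, j ≤ 1 → ∀ c ∈ cubeLamBP L a M ρ k 1 j, ‖linCovIter L U₀ (iEta η φ) j c.1 c.2‖ ≤ N) →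
          (∀ (y : Site d) (τ : Fin d), ¬ BondTouches (cubeFam false L a M ρ k 0) y τ → η * ‖φ y τ‖ ≤ N) →
          ∀ j, j ≤ 1 → ∀ (y : Site d) (τ : Fin d), SideTouches (cubeFam false L a M ρ k j) y τ →
            ((L : ℝ) ^ j * η) * ‖φ y τ‖ ≤ B'' * N ∧
            (∀ ν : Fin d, ((L : ℝ) ^ j * η) ^ 2 * ‖covDerivFwd η U₀ ν (fun z => φ z τ) y‖ ≤ B'' * N) ∧
            ((L : ℝ) ^ j * η) ^ 3 * ‖covLap η U₀ (fun z => φ z τ) y‖ ≤ B'' * N := by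
  obtain ⟨α₀, B'', hα₀, hB'', H⟩ := exists_curved159_perCube_touching_uniform (𝔸 := 𝔸) hd2 hL M hρ hk
  refine ⟨α₀, B'', hα₀, hB'', fun a η hη U₀ hU k' hAk => H a η hη U₀ hU fun z κ μ hκμ hpt => ?_⟩
  have h1 := (hAk 0 (Nat.zero_le _)).1 z κ μ hκμ hpt
  simp only [pow_zero, inv_one, one_pow, mul_one] at h1
  exact h1.le

end TruncOne

/-! ## §2 All truncations: averaging-closed groups, unitary C⋆ backgrounds -/

section Tower

variable {𝔸 : Type*} [NormedRing 𝔸] [NormOneClass 𝔸] [NormedAlgebra ℂ 𝔸] [CompleteSpace 𝔸]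

/-- ★★★ **ALL TRUNCATIONS `1 ≤ m ≤ k` — CONSTANTS UNIFORM IN `a` AND `η`** (`2 ≤ L ≤ ρ`, `G` averaging-closed): `∃ α₀ B″` BEFORE `∀ a, ∀ η > 0` in
`B8Ineq159CurvedCubeMemberInAkVerbatim.exists_curved159_perCube_touching_tower`. [cite: Balaban1985RegularSpaces, (1.59) p.86, (1.62) p.87, p.83; Balaban1985Averaging, Prop. 2 (52)–(54) p.26; Balaban1987RG1, (4.16) p.285; Balaban1985BackgroundPropagators, Thm 3.3 p.399] -/
theorem exists_curved159_perCube_touching_tower_uniform [FiniteDimensional ℂ 𝔸] (hd2 : 2 ≤ d) {L : ℕ} (hL2 : 2 ≤ L)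
    {G : Subgroup 𝔸ˣ} (hG : AvgClosed d L G) (M : ℕ) {ρ : ℕ} (hρ : L ≤ ρ) {k m : ℕ} (hm1 : 1 ≤ m) (hmk : m ≤ k) :
    ∃ α₀ B'' : ℝ, 0 < α₀ ∧ 0 < B'' ∧ ∀ (a : Site d) (η : ℝ), 0 < η → ∀ (U₀ : Site d → Fin d → 𝔸ˣ), (∀ x κ, U₀ x κ ∈ G) →
      (∀ (z : Site d) (κ μ : Fin d), κ ≠ μ → PlaqTouches (cubeFam false L a M ρ k 0) z κ μ → ‖plaqF U₀ κ μ z - 1‖ ≤ α₀) →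
      ∀ φ : Site d → Fin d → 𝔸,
        IsLandau138 L m η (cubeFam false L a M ρ k 0) (cubeLamS L a M ρ k m) U₀ φ →
        (∀ (y : Site d) (τ : Fin d), (∀ j, j ≤ m → ¬ SideTouches (cubeFam false L a M ρ k j) y τ) → φ y τ = 0) →
        ∀ N : ℝ, 0 ≤ N →
          (∀ j, j ≤ m → ∀ (y : Site d) (τ : Fin d), BondTouches (cubeFam false L a M ρ k j) y τ →
              ((L : ℝ) ^ j * η) ^ 3 * ‖Jcur η U₀ φ τ y‖ ≤ N) →
          (∀ j, j ≤ m → ∀ c ∈ cubeLamBP L a M ρ k m j, ‖linCovIter L U₀ (iEta η φ) j c.1 c.2‖ ≤ N) →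
          (∀ (y : Site d) (τ : Fin d), ¬ BondTouches (cubeFam false L a M ρ k 0) y τ → η * ‖φ y τ‖ ≤ N) →
          ∀ j, j ≤ m → ∀ (y : Site d) (τ : Fin d), SideTouches (cubeFam false L a M ρ k j) y τ →
            ((L : ℝ) ^ j * η) * ‖φ y τ‖ ≤ B'' * N ∧
            (∀ ν : Fin d, ((L : ℝ) ^ j * η) ^ 2 * ‖covDerivFwd η U₀ ν (fun z => φ z τ) y‖ ≤ B'' * N) ∧
            ((L : ℝ) ^ j * η) ^ 3 * ‖covLap η U₀ (fun z => φ z τ) y‖ ≤ B'' * N := by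
  have hL : 1 ≤ L := le_trans (by norm_num) hL2
  obtain ⟨α₀, B'', hα₀, hB'', H⟩ := exists_curved159_perCube_touching_tower_uniformEta (𝔸 := 𝔸) hd2 hL2 hG 0 M hρ hm1 hmk
  refine ⟨α₀, B'', hα₀, hB'', fun a η hη => ?_⟩
  have h := curved159_perCube_shift (H := G) hL 0 a M ρ hmk (H η hη)
  rw [zero_add] at h
  exact h

/-- ★★★ **ALL TRUNCATIONS, `InAk` FORM — CONSTANTS UNIFORM IN `a` AND `η`**: `∃ α₀ B″` BEFORE `∀ a, ∀ η > 0` in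
`B8Ineq159CurvedCubeMemberInAkVerbatim.exists_curved159_perCube_inAk_verbatim_tower`. [cite: Balaban1985RegularSpaces, (1.59) p.86, (1.7)–(1.8) p.77; Balaban1987RG1, (4.16) p.285; Balaban1985BackgroundPropagators, Thm 3.3 p.399] -/
theorem exists_curved159_perCube_inAk_verbatim_tower_uniform [FiniteDimensional ℂ 𝔸] (hd2 : 2 ≤ d) {L : ℕ} (hL2 : 2 ≤ L)
    {G : Subgroup 𝔸ˣ} (hG : AvgClosed d L G) (M : ℕ) {ρ : ℕ} (hρ : L ≤ ρ) {k m : ℕ} (hm1 : 1 ≤ m) (hmk : m ≤ k) :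
    ∃ α₀ B'' : ℝ, 0 < α₀ ∧ 0 < B'' ∧ ∀ (a : Site d) (η : ℝ), 0 < η → ∀ (U₀ : Site d → Fin d → 𝔸ˣ), (∀ x κ, U₀ x κ ∈ G) →
      ∀ k' : ℕ, InAk L k' η α₀ (cubeFam false L a M ρ k) U₀ →
      ∀ φ : Site d → Fin d → 𝔸,
        IsLandau138 L m η (cubeFam false L a M ρ k 0) (cubeLamS L a M ρ k m) U₀ φ →
        (∀ (y : Site d) (τ : Fin d), (∀ j, j ≤ m → ¬ SideTouches (cubeFam false L a M ρ k j) y τ) → φ y τ = 0) →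
        ∀ N : ℝ, 0 ≤ N →
          (∀ j, j ≤ m → ∀ (y : Site d) (τ : Fin d), BondTouches (cubeFam false L a M ρ k j) y τ →
              ((L : ℝ) ^ j * η) ^ 3 * ‖Jcur η U₀ φ τ y‖ ≤ N) →
          (∀ j, j ≤ m → ∀ c ∈ cubeLamBP L a M ρ k m j, ‖linCovIter L U₀ (iEta η φ) j c.1 c.2‖ ≤ N) →
          (∀ (y : Site d) (τ : Fin d), ¬ BondTouches (cubeFam false L a M ρ k 0) y τ → η * ‖φ y τ‖ ≤ N) →
          ∀ j, j ≤ m → ∀ (y : Site d) (τ : Fin d), SideTouches (cubeFam false L a M ρ k j) y τ →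
            ((L : ℝ) ^ j * η) * ‖φ y τ‖ ≤ B'' * N ∧
            (∀ ν : Fin d, ((L : ℝ) ^ j * η) ^ 2 * ‖covDerivFwd η U₀ ν (fun z => φ z τ) y‖ ≤ B'' * N) ∧
            ((L : ℝ) ^ j * η) ^ 3 * ‖covLap η U₀ (fun z => φ z τ) y‖ ≤ B'' * N := by
  obtain ⟨α₀, B'', hα₀, hB'', H⟩ := exists_curved159_perCube_touching_tower_uniform (𝔸 := 𝔸) hd2 hL2 hG M hρ hm1 hmk
  refine ⟨α₀, B'', hα₀, hB'', fun a η hη U₀ hU k' hAk => H a η hη U₀ hU fun z κ μ hκμ hpt => ?_⟩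
  have h1 := (hAk 0 (Nat.zero_le _)).1 z κ μ hκμ hpt
  simp only [pow_zero, inv_one, one_pow, mul_one] at h1
  exact h1.le

end Tower

section Unitary

variable {𝔹 : Type*} [CStarAlgebra 𝔹] [Nontrivial 𝔹]

/-- ★ **UNITARY C⋆ BACKGROUNDS — CONSTANTS UNIFORM IN `a` AND `η`** (the sockets' currency: `unitaryUnits`, `InAk L m i.η α₀ i.Ω U₀`, `i.Ω = cubeFam false …`):
for a fixed SHAPE `(L, M, ρ, k)` and truncation `m`, ONE `(α₀, B″)` serves every member of that shape.  PER SHAPE — NOT the uniform [4] Thm 3.3 supply.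
[cite: Balaban1985RegularSpaces, (1.59) p.86, (1.7)–(1.8) p.77; Balaban1985Averaging, (42)–(43) pp.23–24; Balaban1985BackgroundPropagators, Thm 3.3 p.399] -/
theorem exists_curved159_perCube_inAk_verbatim_unitary_uniform [FiniteDimensional ℂ 𝔹] (hd2 : 2 ≤ d) {L : ℕ} (hL2 : 2 ≤ L)
    (M : ℕ) {ρ : ℕ} (hρ : L ≤ ρ) {k m : ℕ} (hm1 : 1 ≤ m) (hmk : m ≤ k) :
    ∃ α₀ B'' : ℝ, 0 < α₀ ∧ 0 < B'' ∧ ∀ (a : Site d) (η : ℝ), 0 < η → ∀ (U₀ : Site d → Fin d → 𝔹ˣ), (∀ x κ, U₀ x κ ∈ unitaryUnits 𝔹) →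
      ∀ k' : ℕ, InAk L k' η α₀ (cubeFam false L a M ρ k) U₀ →
      ∀ φ : Site d → Fin d → 𝔹,
        IsLandau138 L m η (cubeFam false L a M ρ k 0) (cubeLamS L a M ρ k m) U₀ φ →
        (∀ (y : Site d) (τ : Fin d), (∀ j, j ≤ m → ¬ SideTouches (cubeFam false L a M ρ k j) y τ) → φ y τ = 0) →
        ∀ N : ℝ, 0 ≤ N →
          (∀ j, j ≤ m → ∀ (y : Site d) (τ : Fin d), BondTouches (cubeFam false L a M ρ k j) y τ →
              ((L : ℝ) ^ j * η) ^ 3 * ‖Jcur η U₀ φ τ y‖ ≤ N) →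
          (∀ j, j ≤ m → ∀ c ∈ cubeLamBP L a M ρ k m j, ‖linCovIter L U₀ (iEta η φ) j c.1 c.2‖ ≤ N) →
          (∀ (y : Site d) (τ : Fin d), ¬ BondTouches (cubeFam false L a M ρ k 0) y τ → η * ‖φ y τ‖ ≤ N) →
          ∀ j, j ≤ m → ∀ (y : Site d) (τ : Fin d), SideTouches (cubeFam false L a M ρ k j) y τ →
            ((L : ℝ) ^ j * η) * ‖φ y τ‖ ≤ B'' * N ∧
            (∀ ν : Fin d, ((L : ℝ) ^ j * η) ^ 2 * ‖covDerivFwd η U₀ ν (fun z => φ z τ) y‖ ≤ B'' * N) ∧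
            ((L : ℝ) ^ j * η) ^ 3 * ‖covLap η U₀ (fun z => φ z τ) y‖ ≤ B'' * N :=
  exists_curved159_perCube_inAk_verbatim_tower_uniform (𝔸 := 𝔹) hd2 hL2 (avgClosed_unitaryUnits d L) M hρ hm1 hmk

/-- ★ **ANY DOMAIN SEQUENCE WHOSE `Ω₀` CONTAINS `□₀`** (print's admissible `{Ω_j}` with `□₀ ⊂ Ω₀`, p. 99, or the member's own `{□_j}`): for unitary `U₀` and
every `{Ω_j}`, `k′` with `□₀(a) ⊆ Ω₀`, `U₀ ∈ 𝔄_{k′}({Ω_j}, α₀)` (`B8Ineq132.InAk`) implies the (1.59) triple at the member `(L, a, M, ρ, k)`, truncation `m` —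
constants uniform in `a`, `η`, `{Ω_j}`, `k′` (only the level-`0` plaquette clause on the plaquettes touching `□₀` is used, `B8Ineq132.condAt_anti`).
[cite: Balaban1985RegularSpaces, (1.59) p.86, (1.7) p.77, p.77, p.99 («□_j ⊂ Ω_j»); Balaban1985Averaging, (42)–(43) pp.23–24; Balaban1985BackgroundPropagators, Thm 3.3 p.399] -/
theorem exists_curved159_perCube_inAk_sup_unitary_uniform [FiniteDimensional ℂ 𝔹] (hd2 : 2 ≤ d) {L : ℕ} (hL2 : 2 ≤ L)
    (M : ℕ) {ρ : ℕ} (hρ : L ≤ ρ) {k m : ℕ} (hm1 : 1 ≤ m) (hmk : m ≤ k) :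
    ∃ α₀ B'' : ℝ, 0 < α₀ ∧ 0 < B'' ∧ ∀ (a : Site d) (η : ℝ), 0 < η → ∀ (U₀ : Site d → Fin d → 𝔹ˣ), (∀ x κ, U₀ x κ ∈ unitaryUnits 𝔹) →
      ∀ (Ω : ℕ → Set (Site d)) (k' : ℕ), cubeFam false L a M ρ k 0 ⊆ Ω 0 → InAk L k' η α₀ Ω U₀ →
      ∀ φ : Site d → Fin d → 𝔹,
        IsLandau138 L m η (cubeFam false L a M ρ k 0) (cubeLamS L a M ρ k m) U₀ φ →
        (∀ (y : Site d) (τ : Fin d), (∀ j, j ≤ m → ¬ SideTouches (cubeFam false L a M ρ k j) y τ) → φ y τ = 0) →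
        ∀ N : ℝ, 0 ≤ N →
          (∀ j, j ≤ m → ∀ (y : Site d) (τ : Fin d), BondTouches (cubeFam false L a M ρ k j) y τ →
              ((L : ℝ) ^ j * η) ^ 3 * ‖Jcur η U₀ φ τ y‖ ≤ N) →
          (∀ j, j ≤ m → ∀ c ∈ cubeLamBP L a M ρ k m j, ‖linCovIter L U₀ (iEta η φ) j c.1 c.2‖ ≤ N) →
          (∀ (y : Site d) (τ : Fin d), ¬ BondTouches (cubeFam false L a M ρ k 0) y τ → η * ‖φ y τ‖ ≤ N) →
          ∀ j, j ≤ m → ∀ (y : Site d) (τ : Fin d), SideTouches (cubeFam false L a M ρ k j) y τ →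
            ((L : ℝ) ^ j * η) * ‖φ y τ‖ ≤ B'' * N ∧
            (∀ ν : Fin d, ((L : ℝ) ^ j * η) ^ 2 * ‖covDerivFwd η U₀ ν (fun z => φ z τ) y‖ ≤ B'' * N) ∧
            ((L : ℝ) ^ j * η) ^ 3 * ‖covLap η U₀ (fun z => φ z τ) y‖ ≤ B'' * N := by
  obtain ⟨α₀, B'', hα₀, hB'', H⟩ :=
    exists_curved159_perCube_touching_tower_uniform (𝔸 := 𝔹) hd2 hL2 (avgClosed_unitaryUnits d L) M hρ hm1 hmk
  refine ⟨α₀, B'', hα₀, hB'', fun a η hη U₀ hU Ω k' hΩ hAk => H a η hη U₀ hU fun z κ μ hκμ hpt => ?_⟩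
  have h1 := (B8Ineq132.condAt_anti hΩ (hAk 0 (Nat.zero_le _))).1 z κ μ hκμ hpt
  simp only [pow_zero, inv_one, one_pow, mul_one] at h1
  exact h1.le

end Unitary

end Literature.MathematicalPhysics.QuantumFieldTheory.Balaban1983to89.B8Ineq159CurvedCubeMemberUniform

end
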